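import Literature.NumberTheory.DiophantineGeometry.GeneralizedFermatTwoPowerCoefficientAssemblyProofs
import Literature.NumberTheory.DiophantineGeometry.DenesEquationFreyCurveTwoProofs
import Literature.NumberTheory.DiophantineGeometry.DenesEquationWeightTwoLevelsProofs
import Literature.NumberTheory.DiophantineGeometry.DenesEquationLargeExponentsProofs
import Literature.NumberTheory.EllipticCurves.CongruentNumberCurveSupersingular
import Literature.NumberTheory.EllipticCurves.LFunctionSmulProofs
import HarnessLib

/-!
# Dénes' equation along Serre's road: Darmon–Merel 1997, Lemma 2.1, Thm. 3.1, Cor. 3.2 and §4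
# (first paragraph) from Khare–Wintenberger and the local description of `E[p]` (proofs)

Topic `Literature/NumberTheory/DiophantineGeometry`; sixth sibling *proofs* file (theorems only:
no definition, no named fact, no `sorry`) of the named fact
`Literature.NumberTheory.DiophantineGeometry.darmonMerel1997_denesEquation`
(`GeneralizedFermatTwoPowerCoefficient`): H. Darmon, L. Merel, *Winding quotients and some
variants of Fermat's Last Theorem*, J. reine angew. Math. 490 (1997) 81–100, Main Theorem (1),
read in the authors' 26-page version.

## The printed steps (pp. 8–9 of the source) and what is proved here

For the Frey curve `E : Y² = X(X − aᵖ)(X − 2cᵖ)` (`freyCurve (a ^ p) (-(2 * c ^ p))`, §1 (4)) of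
a non-trivial primitive solution of `aᵖ + bᵖ = 2cᵖ` and `ρ = E[p]`:

* **Lemma 2.1 (1)**: "*`N(ρ) = 2` if `abc` is even, and `N(ρ) ∣ 32` if `abc` is odd.* Proof: By
  proposition 1.1, the curve `E` is semistable at all primes except possibly `2` … for all primes
  `ℓ ≠ 2`, one has `ord_ℓ(Δ_min) ≡ 0 (mod p)` … (See, for example, [27], 4.1.12.)"
* **Theorem 3.1 (Ribet)**: "There is a cusp form `f` mod `p` of weight `2` and level `N(ρ)` which
  is associated to `ρ`", obtained in the source from Thm. 1.3 (modularity: Wiles, Taylor–Wiles,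
  Diamond) and Thm. 2.2 (`ρ` absolutely irreducible) by Ribet's level-lowering [24].
* **Corollary 3.2 (1)**: "There are no non-trivial primitive solutions to equation (1) with
  `2 ∣ abc`" ("this representation corresponds to a mod `p` eigenform of weight `2` and level `2`
  … impossible since there are no weight `2` cusp forms of these levels").
* **§4, first paragraph** (p. 9): "we now know that `ρ` corresponds to a mod `p` eigenform of
  weight `2` and level `32`".

Neither modularity (the tree's unproved `exists_isNewformOf`) nor level-lowering (not catalogued)
is available.  Exactly as the sibling files `GeneralizedFermatTwoPowerCoefficient{Serre,Assembly}Proofs`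
do for Ribet's equation `aᵖ + 2^α bᵖ + cᵖ = 0`, `α ≥ 2`, this file runs **Serre's road** instead
(Serre, Duke Math. J. 54 (1987), §4.2–4.3: the argument DM cite as "[27], 4.1.12" and "already
established in [25]"): Serre's conjecture (3.2.4) in the tree's form `Automorphic.khare_wintenberger`
(Khare–Wintenberger 2009, the tree's named fact, hypothesis `hKW`) replaces Thms. 1.3 + 3.1, and
the local description of `ρ̄ = E[p] ⊗ 𝔽̄_p` is taken in the SAME hypothesis format as
`ribet1997_twoPowerFermat_of_khare_wintenberger_of_frey_local` /
`ribet1997_twoPowerFermat_of_khare_wintenberger_of_mazurKenku_of_tate`: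
`hirr` (irreducibility of `E[p]` for Frey curves, here a theorem modulo the named fact
`mazurKenku_exists_cyclic_isogeny`), `hwt` (Serre (4.1.11): weight `2`), `hlevN` (Serre (4.6.3):
`N(ρ̄) ∣ N_E`, here a theorem modulo the named Ogg–Saito fact), `hTate` (Serre (4.1.12): `ρ̄`
unramified at a semistable `ℓ ≠ p` with `p ∣ ord_ℓ Δ_min`).  Proved:

* `denes_eq_two_of_prime_dvd_serreLevel`, `denes_serreLevel_dvd_two_of_even`,
  `denes_serreLevel_dvd_thirtyTwo_of_odd` — Lemma 2.1 (1) in the tree's language (`N(ρ̄) ∣ 2`,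
  resp. `N(ρ̄) ∣ 32`; the inputs `ord_ℓ(Δ_min) ≡ 0 (mod p)`, semistability at odd `ℓ`,
  `N_E = rad(abc)` or `2⁵ rad(abc)` are the tree theorems of `DenesEquationFreyCurve{,Two}Proofs`);
* `denes_false_of_even_of_khare_wintenberger_of_frey_local` — **Cor. 3.2 (1)** (no solution with
  `abc` even, `p ≥ 5`), and its form `…_of_mazurKenku_of_tate` on the three named facts;
* `denes_serreLevel_eq_thirtyTwo_of_odd_of_khare_wintenberger_of_frey_local` — **Thm. 3.1 with
  §4, first paragraph**, for `abc` odd: `N(ρ̄ ⊗ 𝔽̄_p) = 32`, and `ρ̄ ⊗ 𝔽̄_p` arises from a newform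
  of weight `2` on `Γ₁(32)` with trivial character, i.e. from a newform on `Γ₀(32)` (the levels
  dividing `16` carry no cusp forms: `cuspForm_two_gamma0_eq_zero_of_dvd_sixteen`);
* (appended) `denes_lFunction_eq_trivial_of_odd_of_khare_wintenberger_of_frey_local` — **§4, p. 10:
  "`ρ` is isomorphic to … the `p`-division points of `X₀(32)`"** in trace form,
  `a_q(E) ≡ a_q(X₀(32)) (mod p)` for `q ∤ 2p·abc` (`abc` odd), using in addition the modularity of
  the one curve `X₀(32) = freyCurve 1 (-2)` (`exists_isNewformOf`, DM Thm. 1.3);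
* (appended) `denes_lFunction_eq_zero_of_mod_four_eq_three_of_khare_wintenberger_of_frey_local` — the
  trace content of **Prop. 4.1 (1)** at the primes inert in `ℚ(i)`: `a_q(E) ≡ 0 (mod p)` for primes
  `q ≡ 3 (mod 4)`, `q ∤ p·abc` (`abc` odd), since `X₀(32) ≅ E₁ : y² = x³ − x` is supersingular there
  (the tree's `lFunction_congruentNumberCurve_apply_prime_eq_zero`, Ireland–Rosen 18 §4 Thm. 5);
* `darmonMerel1997_denesEquation_of_khare_wintenberger_of_odd` — the named fact from these
  hypotheses, Dénes 1952 for `p = 5` restricted to `abc` odd, and, for prime `p ≥ 7` and `abc`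
  odd, the two printed conclusions `j(E) ∈ ℤ[1/p]` (Thm. 8.1 via Props. 4.1–4.3) and `p ∤ abc`
  (Cor. 4.4) — refining `darmonMerel1997_denesEquation_of_denes_of_large` (§9) by the even case.

## References

* [DarmonMerel1997] H. Darmon, L. Merel, J. reine angew. Math. 490 (1997), 81–100: Lemma 2.1,
  Thm. 2.2, Thm. 3.1, Cor. 3.2 (pp. 8–9), §4 first paragraph (p. 9), Cor. 9.1 (p. 24).
* [Serre1987] J.-P. Serre, Duke Math. J. 54 (1987): §4.1 ((4.1.11)–(4.1.12)), §4.2–4.3, (4.6.3).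
* [KhareWintenberger2009] C. Khare, J.-P. Wintenberger, Invent. Math. 178 (2009), Thm. 1.2, 9.1.
* [Ribet1997] K. A. Ribet, Acta Arith. 79 (1997), Thm. 3 (second sentence: `α = 1`, `abc` even).
* [Mazur1978] B. Mazur, Invent. Math. 44 (1978), Thm. 1; [Kenku1982].
-/

noncomputable section

open scoped MatrixGroups ModularForm NumberField
open CongruenceSubgroup Polynomial
open IsDedekindDomain Rat.HeightOneSpectrum

namespace Literature.NumberTheory.DiophantineGeometry

open WeierstrassCurve GaloisRepresentations EllipticCurves EllipticCurves.ModularForms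
  GaloisRepresentations.ModPGaloisRep GaloisRepresentations.IsNonarchimedeanLocalField ValuativeRel
  IsDedekindDomain.HeightOneSpectrum Literature.NumberTheory.Automorphic
  Literature.NumberTheory.Automorphic.BCDT

/-! ## Part A. Elementary lemmas -/

section Elementary

variable {a b c : ℤ} {p : ℕ}

/-- `aᵖ ≡ −1 (mod 4)` for `a ≡ −1 (mod 4)` and `p` odd (Darmon–Merel §1, p. 5: "assume that
`a ≡ −1 (mod 4)`"; then `A = aᵖ ≡ −1 (mod 4)` is Serre's normalisation). [folklore] -/
theorem pow_modEq_neg_one_four (hpo : Odd p) (ha4 : a ≡ -1 [ZMOD 4]) : a ^ p ≡ -1 [ZMOD 4] := by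
  have := ha4.pow p
  rwa [hpo.neg_one_pow] at this

/-- `16 ∣ B = −2cᵖ` when `c` is even and `p ≥ 3`. [folklore] -/
theorem sixteen_dvd_denes_B (hp : 3 ≤ p) (hc : 2 ∣ c) : (16 : ℤ) ∣ -(2 * c ^ p) := by
  obtain ⟨c', rfl⟩ := hc
  refine dvd_neg.mpr ?_
  calc (16 : ℤ) = 2 ^ 4 := by norm_num
    _ ∣ 2 ^ (p + 1) := pow_dvd_pow 2 (by omega)
    _ ∣ 2 * (2 * c') ^ p := ⟨c' ^ p, by ring⟩

/-- A prime `q > |abc|`, `q ≠ 2`, is a prime of good reduction of the Frey curve of a solution of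
`aᵖ + bᵖ = 2cᵖ` (`abc ≠ 0`, `gcd(a, c) = 1`, `a` odd): `q ∣ N_E ↔ q ∣ abc` at odd `q`
(`dvd_conductorNorm_freyCurve_denes_iff`, DM Prop. 1.1 (1)). [cite: DarmonMerel1997, Prop. 1.1 (1)] -/
theorem not_dvd_conductorNorm_freyCurve_denes_of_lt (hp : 1 ≤ p) (h : a ^ p + b ^ p = 2 * c ^ p)
    (h0 : a * b * c ≠ 0) (hac : IsCoprime a c) (ha : Odd a) {q : ℕ} (hq : q.Prime) (hq2 : q ≠ 2)
    (hlt : (a * b * c).natAbs < q) : ¬ q ∣ (freyCurve (a ^ p) (-(2 * c ^ p))).conductorNorm ℤ := by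
  rw [dvd_conductorNorm_freyCurve_denes_iff hp h h0 hac ha hq hq2]
  intro h'
  exact hlt.not_ge (Nat.le_of_dvd (Int.natAbs_pos.mpr h0) (Int.natCast_dvd.mp h'))

/-- The divisors of `32`. [folklore] -/
theorem eq_of_dvd_thirtyTwo {N : ℕ} (hN : N ∣ 32) :
    N = 1 ∨ N = 2 ∨ N = 4 ∨ N = 8 ∨ N = 16 ∨ N = 32 := by
  have h : N ∈ Nat.divisors 32 := Nat.mem_divisors.mpr ⟨hN, by norm_num⟩
  have : Nat.divisors 32 = {1, 2, 4, 8, 16, 32} := by decide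
  rw [this] at h
  simpa using h

/-- `φ(N) ∣ 16` for `N ∣ 32`, so an odd prime `p` does not divide `φ(N)` (the roots of unity of
order dividing `φ(N)` then reduce injectively modulo `p`; Serre 1987, §3.3 "`ε = 1`").
[folklore] -/
theorem not_dvd_totient_of_dvd_thirtyTwo {N p : ℕ} (hN : N ∣ 32) (hp : p.Prime) (hp2 : p ≠ 2) :
    ¬ p ∣ Nat.totient N := by
  intro h
  have hφ : Nat.totient N ∣ 2 ^ 4 := by
    rcases eq_of_dvd_thirtyTwo hN with rfl | rfl | rfl | rfl | rfl | rfl <;> decide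
  exact hp2 ((Nat.prime_dvd_prime_iff_eq hp Nat.prime_two).mp (hp.dvd_of_dvd_pow (h.trans hφ)))

/-- **A natural number with no odd prime factor, dividing a number `M` with `ord₂ (M) ≤ k`,
divides `2 ^ k`** (generalising `dvd_eight_of_forall_prime` of the sibling Serre file).
[folklore] -/
theorem dvd_two_pow_of_forall_prime {N M k : ℕ} (hN0 : N ≠ 0) (hNM : N ∣ M) (hM0 : M ≠ 0)
    (hodd : ∀ q : ℕ, q.Prime → q ∣ N → q = 2) (hM : M.factorization 2 ≤ k) : N ∣ 2 ^ k := by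
  obtain ⟨e, he⟩ : ∃ e : ℕ, N = 2 ^ e :=
    ⟨_, Nat.eq_prime_pow_of_unique_prime_dvd hN0 fun {d} hd hdN ↦ hodd d hd hdN⟩
  have h2M : 2 ^ e ∣ M := he ▸ hNM
  have hle : e ≤ M.factorization 2 := (Nat.prime_two.pow_dvd_iff_le_factorization hM0).mp h2M
  rw [he]
  exact Nat.pow_dvd_pow 2 (hle.trans hM)

/-- `ord₂ (N_E) = 5` for the Frey curve of a solution of `aᵖ + bᵖ = 2cᵖ` with `a`, `c` odd
(`conductorExponent_freyCurve_denes_two`: type `III`, `f₂ = 5`; DM Prop. 1.1 (1), second case).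
[cite: DarmonMerel1997, Prop. 1.1 (1)] -/
theorem factorization_conductorNorm_freyCurve_denes_two_of_odd (h : a ^ p + b ^ p = 2 * c ^ p)
    (h0 : a * b * c ≠ 0) (ha : Odd a) (hc : Odd c) :
    ((freyCurve (a ^ p) (-(2 * c ^ p))).conductorNorm ℤ).factorization 2 = 5 := by
  haveI := isElliptic_freyCurve_denes h h0
  rw [show (2 : ℕ) = ((⟨2, Nat.prime_two⟩ : Nat.Primes) : ℕ) from rfl,
    factorization_conductorNorm_primesEquiv_symm]
  exact conductorExponent_freyCurve_denes_two h h0 ha hc _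
    (Literature.NumberTheory.EllipticCurves.Rat.natGenerator_primesEquiv_symm _)

end Elementary

/-! ## Part B. The newform side: trivial nebentypus as soon as `p ∤ φ(N)` -/

/-- **`ε_f = 1` for a newform carrying `E[p] ⊗ K` when `p ∤ φ(N)`** (Serre 1987, §3.3 and §4.2;
the first half of the sibling `false_of_isGaloisRepOfNewform1Int_of_dvd_eight`, with its
hypothesis `N ∣ 8`, `p ≥ 5` weakened to `p ∤ φ(N)` — all that is used).  Let `W/ℚ` be elliptic,
`ρ̄` a framed model of `E[p]`, `j : 𝔽_p → K` (`K` discrete of characteristic `p`), and suppose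
`ρ̄ ⊗ K` is attached (`IsGaloisRepOfNewform1Int`, away from `N p`) to `f ∈ S₂(Γ₁(N))` along
`ι : 𝓞_f → K`.  At every prime `q > max(p, B₀)`, `q ∤ N`, of good reduction the Frobenius
polynomial of `E[p]` is `X² − a_q X + q` (`charpoly_baseChange_of_isTorsionGaloisRep`), so
`ι(ε_f(q) q) = q` and `ε_f(q) = 1`
(`nebentypus_apply_eq_one_of_map_coeff_zero_eq_of_not_dvd_totient`); by Dirichlet
(`nebentypus_eq_one_of_forall_prime`) `ε_f = 1`. [cite: Serre1987, §3.3 and §4.2] -/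
theorem nebentypus_eq_one_of_isGaloisRepOfNewform1Int_of_not_dvd_totient
    (W : WeierstrassCurve ℚ) [W.IsElliptic] {p : ℕ} [Fact p.Prime]
    {ρ : ModPGaloisRep ℚ (ZMod p) 2} (hρ : W.IsTorsionGaloisRep p ρ) {K : Type} [Field K]
    [CharP K p] [TopologicalSpace K] [DiscreteTopology K] (j : ZMod p →+* K) {N : ℕ} [NeZero N]
    (hpN : ¬ p ∣ Nat.totient N) {f : CuspForm (Gamma1 N) 2} (ιf : coeffCharIntegers f →+* K)
    (hgal : IsGaloisRepOfNewform1Int f ιf {q | q ∣ N * p}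
      (FramedRep.baseChange j continuous_of_discreteTopology ρ))
    (B₀ : ℕ) (hgoodB : ∀ q : ℕ, q.Prime → B₀ < q → ¬ q ∣ W.conductorNorm ℤ) :
    nebentypus f = 1 := by
  classical
  have hp : p.Prime := Fact.out
  refine nebentypus_eq_one_of_forall_prime (max p B₀) ?_
  intro q hq hqB hqN
  have hqp : q ≠ p := fun h' ↦ (lt_of_le_of_lt (le_max_left _ _) hqB).ne' h'
  have hqNE : ¬ q ∣ W.conductorNorm ℤ := hgoodB q hq (lt_of_le_of_lt (le_max_right _ _) hqB)
  obtain ⟨v, rfl⟩ : ∃ v : HeightOneSpectrum (𝓞 ℚ), (primesEquiv v : ℕ) = q :=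
    ⟨primesEquiv.symm ⟨q, hq⟩, by rw [Equiv.apply_symm_apply]⟩
  have hvS : ((primesEquiv v : Nat.Primes) : ℕ) ∉ {q | q ∣ N * p} := by
    intro h'
    rcases (Nat.Prime.dvd_mul hq).mp h' with h1 | h1
    · exact hqN h1
    · exact hqp ((Nat.prime_dvd_prime_iff_eq hq hp).mp h1)
  obtain ⟨-, P, hP, hch⟩ := hgal v hvS
  obtain ⟨𝔓, h𝔓⟩ := primesAbove_nonempty v
  obtain ⟨σ, hσ⟩ := exists_isArithFrobAt_of_mem_primesAbove_holds (v := v) h𝔓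
  have hgood : W.HasGoodReductionAt v := by
    by_contra h'
    exact hqNE ((W.dvd_conductorNorm_iff v).mpr h')
  have h1 := hch 𝔓 h𝔓 σ hσ
  rw [charpoly_baseChange_of_isTorsionGaloisRep W hρ j _ hqp hgood h𝔓 hσ] at h1
  have h2 := congrArg (fun Q : Polynomial K ↦ Q.coeff 0) h1
  simp only [Polynomial.coeff_map, coeff_add, coeff_sub, coeff_X_pow, coeff_C_mul,
    coeff_X_zero, coeff_C_zero] at h2
  have h0' : ιf (P.coeff 0) = ((primesEquiv v : ℕ) : K) := by
    rw [← h2]; simp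
  exact nebentypus_apply_eq_one_of_map_coeff_zero_eq_of_not_dvd_totient hq hqN hP ιf hqp hpN h0'

/-- **"`a_ℓ(f) = trace(ρ(Frob_ℓ))`" — the printed sense of "associated" in Darmon–Merel's
Thm. 3.1** ("There is a cusp form `f` mod `p` of weight `2` and level `N(ρ)` which is associated to
`ρ` in the sense that `a_ℓ(f) = trace(ρ(Frob_ℓ))` for all `ℓ ∤ pN(ρ)`"), extracted from the tree's
predicate `IsGaloisRepOfNewform1Int`: if `ρ̄ ⊗ K` (`ρ̄` a framed model of `E[p]`) is attached to
`f ∈ S₂(Γ₁(N))` along `ι : 𝓞_f → K` away from `S`, then at every prime `q ∉ S`, `q ≠ p`, of good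
reduction there is `A ∈ 𝓞_f` with `A = a_q(f)` in `ℂ` and `ι(A) = a_q(E)` in `K` — compare the
`X`-coefficients of `char(Frob_q | E[p] ⊗ K) = X² − a_q(E) X + q`
(`charpoly_baseChange_of_isTorsionGaloisRep`) and of `ι(P) `, `P ↦ X² − a_q(f) X + ε(q) q`
(`coeff_of_map_eq_heckePolynomial`). [cite: DarmonMerel1997, Thm. 3.1] [cite: Serre1987, §4.6] -/
theorem exists_coeff_eq_lFunction_of_isGaloisRepOfNewform1Int
    (W : WeierstrassCurve ℚ) [W.IsElliptic] {p : ℕ} [Fact p.Prime]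
    {ρ : ModPGaloisRep ℚ (ZMod p) 2} (hρ : W.IsTorsionGaloisRep p ρ) {K : Type} [Field K]
    [TopologicalSpace K] [DiscreteTopology K] (j : ZMod p →+* K) {N : ℕ} [NeZero N]
    {f : CuspForm (Gamma1 N) 2} (ιf : coeffCharIntegers f →+* K) {S : Set ℕ}
    (hgal : IsGaloisRepOfNewform1Int f ιf S (FramedRep.baseChange j continuous_of_discreteTopology ρ))
    {q : ℕ} (hq : q.Prime) (hqS : q ∉ S) (hqp : q ≠ p) (hgood : ¬ q ∣ W.conductorNorm ℤ) :
    ∃ A : coeffCharIntegers f,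
      (algebraMap (coeffCharField f) ℂ) (algebraMap (coeffCharIntegers f) (coeffCharField f) A) =
          (UpperHalfPlane.qExpansion 1 ⇑f).coeff q ∧
        ιf A = ((W.LFunction q : ℤ) : K) := by
  classical
  obtain ⟨v, rfl⟩ : ∃ v : HeightOneSpectrum (𝓞 ℚ), (primesEquiv v : ℕ) = q :=
    ⟨primesEquiv.symm ⟨q, hq⟩, by rw [Equiv.apply_symm_apply]⟩
  obtain ⟨-, P, hP, hch⟩ := hgal v hqS
  obtain ⟨𝔓, h𝔓⟩ := primesAbove_nonempty v
  obtain ⟨σ, hσ⟩ := exists_isArithFrobAt_of_mem_primesAbove_holds (v := v) h𝔓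
  have hgood' : W.HasGoodReductionAt v := by
    by_contra h'
    exact hgood ((W.dvd_conductorNorm_iff v).mpr h')
  have h1 := hch 𝔓 h𝔓 σ hσ
  rw [charpoly_baseChange_of_isTorsionGaloisRep W hρ j _ hqp hgood' h𝔓 hσ] at h1
  have h2 := congrArg (fun Q : Polynomial K ↦ Q.coeff 1) h1
  simp only [Polynomial.coeff_map, coeff_add, coeff_sub, coeff_X_pow, coeff_C_mul, coeff_X_one,
    coeff_C, mul_one] at h2
  norm_num at h2
  refine ⟨-P.coeff 1, ?_, ?_⟩
  · rw [map_neg, map_neg, (coeff_of_map_eq_heckePolynomial hP).1, neg_neg]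
  · rw [map_neg, ← h2, neg_neg]

/-! ## Part C. Darmon–Merel Lemma 2.1 (1), Cor. 3.2 (1), Thm. 3.1 and §4 along Serre's road -/

section SerreRoad

variable
  (hKW : ∀ (p : ℕ) [Fact p.Prime] (k : Type) [Field k] [TopologicalSpace k] [DiscreteTopology k],
    khare_wintenberger p k)
  (hirr : ∀ (A B : ℤ) (p : ℕ), p.Prime → 5 ≤ p → IsCoprime A B → A * B * (A + B) ≠ 0 →
    A ≡ -1 [ZMOD 4] → (2 : ℤ) ∣ B → (freyCurve A B).HasIrreducibleModPGaloisRep p)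
  (hwt : ∀ (W : WeierstrassCurve ℚ) [W.IsElliptic] (p : ℕ) [Fact p.Prime], 5 ≤ p →
    W.IsSemistableAt ((primesEquiv (R := ℤ)).symm ⟨p, Fact.out⟩) →
    p ∣ W.ordMinimalDiscriminant ((primesEquiv (R := ℤ)).symm ⟨p, Fact.out⟩) →
    ∀ ρ : ModPGaloisRep ℚ (ZMod p) 2, W.IsTorsionGaloisRep p ρ →
      ∀ (k : Type) [Field k] [TopologicalSpace k] [DiscreteTopology k] [CharP k p]
        [IsAlgClosed k] (j : ZMod p →+* k)
        (loc : LocalRestrictionAt p (FramedRep.baseChange j continuous_of_discreteTopology ρ))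
        (ι : absIntegers 𝒪[loc.F] loc.F ⧸ absMaximalIdeal loc.F →+* k),
        serreWeight p (FramedRep.baseChange j continuous_of_discreteTopology ρ) loc ι = 2)
  (hlevN : ∀ (W : WeierstrassCurve ℚ) [W.IsElliptic] (p : ℕ) [Fact p.Prime],
    ∀ ρ : ModPGaloisRep ℚ (ZMod p) 2, W.IsTorsionGaloisRep p ρ →
      ∀ (k : Type) [Field k] [TopologicalSpace k] [DiscreteTopology k] [CharP k p]
        [IsAlgClosed k] (j : ZMod p →+* k),
        serreLevel p (FramedRep.baseChange j continuous_of_discreteTopology ρ) ∣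
          W.conductorNorm ℤ)
  (hTate : ∀ (W : WeierstrassCurve ℚ) [W.IsElliptic] (p : ℕ) [Fact p.Prime],
    ∀ ρ : ModPGaloisRep ℚ (ZMod p) 2, W.IsTorsionGaloisRep p ρ →
      ∀ (k : Type) [Field k] [TopologicalSpace k] [DiscreteTopology k] [CharP k p]
        [IsAlgClosed k] (j : ZMod p →+* k) (v : HeightOneSpectrum ℤ),
        natGenerator v ≠ p → W.IsSemistableAt v → p ∣ W.ordMinimalDiscriminant v →
          ¬ natGenerator v ∣ serreLevel p (FramedRep.baseChange j continuous_of_discreteTopology ρ))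

/-! ### Lemma 2.1 (1): the level of `ρ̄ = E[p] ⊗ 𝔽̄_p` -/

include hTate in
/-- **Darmon–Merel 1997, proof of Lemma 2.1: no odd prime divides `N(ρ)`** ("the curve `E` is
semistable at all primes except possibly `2` … for all primes `ℓ ≠ 2`, one has
`ord_ℓ(Δ_min) ≡ 0 (mod p)` … See [27], 4.1.12").  For the Frey curve
`E : Y² = X(X − aᵖ)(X − 2cᵖ)` of a solution of `aᵖ + bᵖ = 2cᵖ` (`abc ≠ 0`, `gcd(a, c) = 1`, `a`
odd), a framed model `ρ̄` of `E[p]` and `ρ̄' = ρ̄ ⊗ k`: every prime `q ∣ N(ρ̄')` equals `2`.  For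
`q = p` this is built into Serre's prime-to-`p` conductor (`not_dvd_serreLevel`); for odd `q ≠ p`
it is Serre's (4.1.12) (`hTate`) fed with the tree theorems `isSemistableAt_freyCurve_denes` and
`dvd_ordMinimalDiscriminant_freyCurve_denes` (`ord_q(Δ_min) = 2p · ord_q(abc)`).
[cite: DarmonMerel1997, Lemma 2.1 (proof)] [cite: Serre1987, §4.1 (4.1.12)] -/
theorem denes_eq_two_of_prime_dvd_serreLevel {p : ℕ} [Fact p.Prime] {a b c : ℤ}
    (h0 : a * b * c ≠ 0) (hac : IsCoprime a c) (ha : Odd a) (h : a ^ p + b ^ p = 2 * c ^ p)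
    {ρ : ModPGaloisRep ℚ (ZMod p) 2}
    (hρ : (freyCurve (a ^ p) (-(2 * c ^ p))).IsTorsionGaloisRep p ρ)
    (k : Type) [Field k] [TopologicalSpace k] [DiscreteTopology k] [CharP k p] [IsAlgClosed k]
    (j : ZMod p →+* k) {q : ℕ} (hq : q.Prime)
    (hqN : q ∣ serreLevel p (FramedRep.baseChange j continuous_of_discreteTopology ρ)) :
    q = 2 := by
  haveI := isElliptic_freyCurve_denes h h0
  by_contra hq2
  have hqp : q ≠ p := by
    rintro rfl
    exact not_dvd_serreLevel _ _ hqN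
  set u : HeightOneSpectrum ℤ := (primesEquiv (R := ℤ)).symm ⟨q, hq⟩ with hu_def
  have hu : natGenerator u = q :=
    Literature.NumberTheory.EllipticCurves.Rat.natGenerator_primesEquiv_symm ⟨q, hq⟩
  have hordu : p ∣ (freyCurve (a ^ p) (-(2 * c ^ p))).ordMinimalDiscriminant u :=
    dvd_ordMinimalDiscriminant_freyCurve_denes h h0 hac ha u (by rw [hu]; exact hq2)
  have hsemiu : (freyCurve (a ^ p) (-(2 * c ^ p))).IsSemistableAt u :=
    isSemistableAt_freyCurve_denes h h0 hac ha u (by rw [hu]; exact hq2)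
  have := hTate (freyCurve (a ^ p) (-(2 * c ^ p))) p ρ hρ k j u (by rw [hu]; exact hqp)
    hsemiu hordu
  exact this (by rw [hu]; exact hqN)

include hlevN hTate in
/-- **Darmon–Merel 1997, Lemma 2.1 (1), even case: "`N(ρ) = 2` if `abc` is even"**, in the form
`N(ρ̄ ⊗ k) ∣ 2` (the tree's `serreLevel` of the base change of a framed model of `E[p]` to an
algebraically closed `k`; the printed equality also uses the converse of Tate's criterion at `2`).
Hypotheses: a solution of `aᵖ + bᵖ = 2cᵖ`, `p` an odd prime, `abc ≠ 0`, `gcd(a, c) = 1`,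
normalised by `a ≡ −1 (mod 4)` (§1, p. 5), with `c` even (i.e. `abc` even, `a, b` being odd).
Proof: odd primes are excluded by `denes_eq_two_of_prime_dvd_serreLevel`; `N(ρ̄) ∣ N_E` (Serre
(4.6.3), `hlevN`) and `ord₂(N_E) ≤ 1` since `E` is semistable at `2` under Serre's normalisation
`A ≡ −1 (mod 4)`, `16 ∣ B = −2cᵖ` (`factorization_conductorNorm_freyCurve_two_le_one`; DM
Prop. 1.1 (1): `N = rad(abc)`). [cite: DarmonMerel1997, Lemma 2.1 (1)]
[cite: Serre1987, §4.1 (4.1.12) and (4.6.3)] -/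
theorem denes_serreLevel_dvd_two_of_even {p : ℕ} [Fact p.Prime] (hp2 : p ≠ 2) {a b c : ℤ}
    (h0 : a * b * c ≠ 0) (hac : IsCoprime a c) (ha4 : a ≡ -1 [ZMOD 4]) (hc : 2 ∣ c)
    (h : a ^ p + b ^ p = 2 * c ^ p) {ρ : ModPGaloisRep ℚ (ZMod p) 2}
    (hρ : (freyCurve (a ^ p) (-(2 * c ^ p))).IsTorsionGaloisRep p ρ)
    (k : Type) [Field k] [TopologicalSpace k] [DiscreteTopology k] [CharP k p] [IsAlgClosed k]
    (j : ZMod p →+* k) :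
    serreLevel p (FramedRep.baseChange j continuous_of_discreteTopology ρ) ∣ 2 := by
  have hp : p.Prime := Fact.out
  have hp3 : 3 ≤ p := by have := hp.two_le; omega
  have hodd : Odd p := hp.odd_of_ne_two hp2
  have ha : Odd a := odd_of_modEq_neg_one_four ha4
  have hcop : IsCoprime (a ^ p) (-(2 * c ^ p)) := isCoprime_denes_frey hac ha
  have hne := denes_frey_ne_zero h h0
  haveI := isElliptic_freyCurve hne
  have hA : a ^ p ≡ -1 [ZMOD 4] := pow_modEq_neg_one_four hodd ha4
  have hB16 : (16 : ℤ) ∣ -(2 * c ^ p) := sixteen_dvd_denes_B hp3 hc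
  set N : ℕ := serreLevel p (FramedRep.baseChange j continuous_of_discreteTopology ρ) with hN_def
  have hN0 : N ≠ 0 := fun h0' ↦
    not_dvd_serreLevel p (FramedRep.baseChange j continuous_of_discreteTopology ρ)
      (by rw [← hN_def, h0']; exact dvd_zero p)
  have hNE : N ∣ (freyCurve (a ^ p) (-(2 * c ^ p))).conductorNorm ℤ := hlevN _ p ρ hρ k j
  have h2 : N ∣ 2 ^ 1 := by
    refine dvd_two_pow_of_forall_prime hN0 hNE (conductorNorm_pos_holds _).ne' ?_ ?_
    · intro q hq hqN
      exact denes_eq_two_of_prime_dvd_serreLevel hTate h0 hac ha h hρ k j hq hqN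
    · exact factorization_conductorNorm_freyCurve_two_le_one hcop hne hA hB16
  simpa using h2

include hlevN hTate in
/-- **Darmon–Merel 1997, Lemma 2.1 (1), odd case: "`N(ρ) ∣ 32` if `abc` is odd"**, as
`N(ρ̄ ⊗ k) ∣ 32`, for a solution of `aᵖ + bᵖ = 2cᵖ` (`abc ≠ 0`, `gcd(a, c) = 1`) with `a` and `c`
odd (no sign normalisation is needed in this case).  Proof: odd primes are excluded by
`denes_eq_two_of_prime_dvd_serreLevel`, and `N(ρ̄) ∣ N_E = 2⁵ rad(abc)` (`hlevN`; DM Prop. 1.1 (1),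
second case: `factorization_conductorNorm_freyCurve_denes_two_of_odd`, Tate's algorithm at `2`).
[cite: DarmonMerel1997, Lemma 2.1 (1)] [cite: Serre1987, §4.1 (4.1.12) and (4.6.3)] -/
theorem denes_serreLevel_dvd_thirtyTwo_of_odd {p : ℕ} [Fact p.Prime] {a b c : ℤ}
    (h0 : a * b * c ≠ 0) (hac : IsCoprime a c) (ha : Odd a) (hc : Odd c)
    (h : a ^ p + b ^ p = 2 * c ^ p) {ρ : ModPGaloisRep ℚ (ZMod p) 2}
    (hρ : (freyCurve (a ^ p) (-(2 * c ^ p))).IsTorsionGaloisRep p ρ)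
    (k : Type) [Field k] [TopologicalSpace k] [DiscreteTopology k] [CharP k p] [IsAlgClosed k]
    (j : ZMod p →+* k) :
    serreLevel p (FramedRep.baseChange j continuous_of_discreteTopology ρ) ∣ 32 := by
  haveI := isElliptic_freyCurve_denes h h0
  set N : ℕ := serreLevel p (FramedRep.baseChange j continuous_of_discreteTopology ρ) with hN_def
  have hN0 : N ≠ 0 := fun h0' ↦
    not_dvd_serreLevel p (FramedRep.baseChange j continuous_of_discreteTopology ρ)
      (by rw [← hN_def, h0']; exact dvd_zero p)
  have hNE : N ∣ (freyCurve (a ^ p) (-(2 * c ^ p))).conductorNorm ℤ := hlevN _ p ρ hρ k j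
  have h32 : N ∣ 2 ^ 5 := by
    refine dvd_two_pow_of_forall_prime hN0 hNE (conductorNorm_pos_holds _).ne' ?_ ?_
    · intro q hq hqN
      exact denes_eq_two_of_prime_dvd_serreLevel hTate h0 hac ha h hρ k j hq hqN
    · exact (factorization_conductorNorm_freyCurve_denes_two_of_odd h h0 ha hc).le
  simpa using h32

/-! ### Cor. 3.2 (1): no solution with `abc` even -/

include hKW hirr hwt hlevN hTate in
/-- **Darmon–Merel 1997, Cor. 3.2 (1), normalised form, along Serre's road.**  There is no
solution of `aᵖ + bᵖ = 2cᵖ` with `p ≥ 5` prime, `abc ≠ 0`, `gcd(a, c) = 1`, `a ≡ −1 (mod 4)` and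
`c` even.  Printed proof (p. 9): such a solution "would give rise, by lemma 2.1, to a modular
irreducible mod `p` Galois representation of conductor `2`. By theorem 3.1, this representation
corresponds to a mod `p` eigenform of weight `2` and level `2`. This is impossible since there are
no weight `2` cusp forms of these levels".  Here, with `E = freyCurve (a ^ p) (-(2 * c ^ p))` and a
framed model `ρ̄` of `E[p]` (`exists_isTorsionGaloisRep`): `ρ̄' = ρ̄ ⊗ 𝔽̄_p` is irreducible
(`hirr` — DM Thm. 2.2 — with Serre's (b′) ⇒ (b), `isAbsolutelyIrreducible_of_hasIrreducibleModPGaloisRep`)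
and odd (`det ρ̄ = χ̄_p`); Serre's conjecture (`hKW`, replacing Thms. 1.3 and 3.1) attaches it to
a newform `f` of weight `k(ρ̄') = 2` (`hwt`: `E` is semistable at `p` with `p ∣ ord_p(Δ_min)`)
and level `N(ρ̄') ∣ 2` (`denes_serreLevel_dvd_two_of_even`); the sibling
`false_of_isGaloisRepOfNewform1Int_of_dvd_eight` (levels dividing `8` carry no weight-`2` cusp
forms) concludes. [cite: DarmonMerel1997, Cor. 3.2 (1)] [cite: Serre1987, §4.2–4.3]
[cite: KhareWintenberger2009, Thm. 1.2] -/
theorem denes_false_of_even_of_normalized_of_khare_wintenberger_of_frey_local {p : ℕ}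
    (hp : p.Prime) (h5 : 5 ≤ p) {a b c : ℤ} (h0 : a * b * c ≠ 0) (hac : IsCoprime a c)
    (ha4 : a ≡ -1 [ZMOD 4]) (hc : 2 ∣ c) (h : a ^ p + b ^ p = 2 * c ^ p) : False := by
  classical
  haveI hpF : Fact p.Prime := ⟨hp⟩
  have hp2 : p ≠ 2 := by omega
  have hodd : Odd p := hp.odd_of_ne_two hp2
  have ha : Odd a := odd_of_modEq_neg_one_four ha4
  have hcop : IsCoprime (a ^ p) (-(2 * c ^ p)) := isCoprime_denes_frey hac ha
  have hne := denes_frey_ne_zero h h0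
  have hA : a ^ p ≡ -1 [ZMOD 4] := pow_modEq_neg_one_four hodd ha4
  have hB2 : (2 : ℤ) ∣ -(2 * c ^ p) := dvd_neg.mpr (dvd_mul_right 2 _)
  set W : WeierstrassCurve ℚ := freyCurve (a ^ p) (-(2 * c ^ p)) with hW
  haveI hWE : W.IsElliptic := isElliptic_freyCurve hne
  /- Step 1. A framed model `ρ̄` of `E[p]` and `ρ̄' = ρ̄ ⊗ 𝔽̄_p`, irreducible and odd. -/
  haveI : NeZero ((p : ℕ) : ℚ) := ⟨by exact_mod_cast hp.ne_zero⟩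
  obtain ⟨ρ, hρ⟩ := W.exists_isTorsionGaloisRep p
  letI : TopologicalSpace (AlgebraicClosure (ZMod p)) := ⊥
  haveI : DiscreteTopology (AlgebraicClosure (ZMod p)) := ⟨rfl⟩
  set j : ZMod p →+* AlgebraicClosure (ZMod p) := algebraMap (ZMod p) (AlgebraicClosure (ZMod p))
    with hj
  set ρ' : ModPGaloisRep ℚ (AlgebraicClosure (ZMod p)) 2 :=
    FramedRep.baseChange j continuous_of_discreteTopology ρ with hρ'
  have habs := isAbsolutelyIrreducible_of_hasIrreducibleModPGaloisRep W hp2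
    (hirr _ _ p hp h5 hcop hne hA hB2) hρ
  have hirr' : ρ'.toGaloisRep.IsIrreducible := by
    rw [← ModPGaloisRep.isIrreducible_iff_toGaloisRep]
    exact habs.isIrreducible_baseChange (AlgebraicClosure (ZMod p)) j _
  have hodd' : FramedGaloisRep.IsOdd ρ' :=
    (ModPGaloisRep.isOdd_of_det_eq_modPCyclotomicCharacterZMod ρ
      (W.det_eq_modPCyclotomicCharacter_of_isTorsionGaloisRep_holds p ρ hρ)).baseChange j _
  /- Step 2. Serre's conjecture: `ρ̄'` arises from a newform of weight `k(ρ̄')`, level `N(ρ̄')`. -/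
  obtain ⟨loc⟩ := nonempty_localRestrictionAt p ρ'
  obtain ⟨ι⟩ := nonempty_ringHom_residue (k := AlgebraicClosure (ZMod p)) p loc.F
    loc.residueFieldCard_eq
  /- Step 3. The weight is `2` (`hwt`). -/
  set vp : HeightOneSpectrum ℤ := (primesEquiv (R := ℤ)).symm ⟨p, hp⟩ with hvp_def
  have hvp : natGenerator vp = p :=
    Literature.NumberTheory.EllipticCurves.Rat.natGenerator_primesEquiv_symm ⟨p, hp⟩
  have hpord : p ∣ W.ordMinimalDiscriminant vp :=
    dvd_ordMinimalDiscriminant_freyCurve_denes h h0 hac ha vp (by rw [hvp]; exact hp2)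
  have hsemi : W.IsSemistableAt vp :=
    isSemistableAt_freyCurve_denes h h0 hac ha vp (by rw [hvp]; exact hp2)
  have hw : (serreWeight p ρ' loc ι : ℤ) = 2 := by
    have h2 : serreWeight p ρ' loc ι = 2 :=
      hwt W p h5 hsemi hpord ρ hρ (AlgebraicClosure (ZMod p)) j loc ι
    rw [h2]; rfl
  obtain ⟨f, ιf, hf, hgal⟩ := hKW p (AlgebraicClosure (ZMod p)) ρ' hirr' hodd' loc ι
  revert hgal hf ιf f
  rw [hw]
  intro f ιf hf hgal
  /- Step 4. The level divides `2`, hence `8` (Lemma 2.1 (1)). -/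
  set N : ℕ := serreLevel p ρ' with hN_def
  haveI hNz : NeZero N :=
    ⟨fun h0' ↦ not_dvd_serreLevel p ρ' (by rw [← hN_def, h0']; exact dvd_zero p)⟩
  have hN2 : N ∣ 2 := denes_serreLevel_dvd_two_of_even hlevN hTate hp2 h0 hac ha4 hc h hρ _ j
  have hN8 : N ∣ 8 := hN2.trans (by norm_num)
  /- Step 5. The primes `q > |abc|` are primes of good reduction; no newform of level `∣ 8`. -/
  exact false_of_isGaloisRepOfNewform1Int_of_dvd_eight W h5 hρ j hN8 hf ιf hgal
    (max 2 (a * b * c).natAbs) fun q hq hqB ↦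
      not_dvd_conductorNorm_freyCurve_denes_of_lt (by omega) h h0 hac ha hq
        (fun h' ↦ (lt_of_le_of_lt (le_max_left _ _) hqB).ne' h')
        (lt_of_le_of_lt (le_max_right _ _) hqB)

include hKW hirr hwt hlevN hTate in
/-- **Darmon–Merel 1997, Cor. 3.2 (1), along Serre's road: "There are no non-trivial primitive
solutions to equation (1) with `2 ∣ abc`"** — for every prime `p ≥ 5` (the source: `p ≥ 7`; the
argument only needs `p ≥ 5`), there is no solution of `aᵖ + bᵖ = 2cᵖ` with `abc ≠ 0`,
`gcd(a, b) = gcd(a, c) = 1` and `c` even (`abc` even means `c` even, since `a` and `b` are odd,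
`odd_of_denes`).  The sign normalisation `a ≡ −1 (mod 4)` of §1 is obtained by passing to
`(−a, −b, −c)` if necessary (`denes_neg_solution`); then
`denes_false_of_even_of_normalized_of_khare_wintenberger_of_frey_local`.  This is also the second
sentence of Ribet 1997, Thm. 3 (`α = 1`, `abc` even). [cite: DarmonMerel1997, Cor. 3.2 (1)]
[cite: Ribet1997, Thm. 3] [cite: Serre1987, §4.2–4.3] [cite: KhareWintenberger2009, Thm. 1.2] -/
theorem denes_false_of_even_of_khare_wintenberger_of_frey_local {p : ℕ} (hp : p.Prime)
    (h5 : 5 ≤ p) {a b c : ℤ} (h0 : a * b * c ≠ 0) (hab : IsCoprime a b) (hac : IsCoprime a c)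
    (hc : 2 ∣ c) (h : a ^ p + b ^ p = 2 * c ^ p) : False := by
  have hodd : Odd p := hp.odd_of_ne_two (by omega)
  have ha : Odd a := (odd_of_denes (by omega) h hab).1
  rcases modEq_neg_one_or_neg_modEq_neg_one_of_odd ha with ha4 | ha4
  · exact denes_false_of_even_of_normalized_of_khare_wintenberger_of_frey_local hKW hirr hwt hlevN
      hTate hp h5 h0 hac ha4 hc h
  · refine denes_false_of_even_of_normalized_of_khare_wintenberger_of_frey_local hKW hirr hwt
      hlevN hTate hp h5 (a := -a) (b := -b) (c := -c) ?_ hac.neg_neg ha4 (dvd_neg.mpr hc)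
      (denes_neg_solution hodd h)
    intro h'; apply h0; linear_combination -h'

/-! ### Thm. 3.1 and §4, first paragraph: for `abc` odd the level is exactly `32` -/

include hKW hirr hwt hlevN hTate in
/-- **Darmon–Merel 1997, Thm. 3.1 with §4, first paragraph, along Serre's road: for `abc` odd,
"`ρ` corresponds to a mod `p` eigenform of weight `2` and level `32`".**  Let `aᵖ + bᵖ = 2cᵖ` with
`p ≥ 5` prime, `abc ≠ 0`, `gcd(a, c) = 1`, `a ≡ −1 (mod 4)` and `c` odd, `E` its Frey curve,
`ρ̄` a framed model of `E[p]` and `ρ̄' = ρ̄ ⊗ k` its extension of scalars to an algebraically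
closed discrete `k` of characteristic `p`.  Then `N(ρ̄') = 32`, and there are a newform
`f ∈ S₂(Γ₁(N(ρ̄')))` with trivial nebentypus and `ι : 𝓞_f → k` such that `ρ̄'` is attached to `f`
along `ι` away from `2p` (`IsGaloisRepOfNewform1Int`), `f` being the image of a newform on
`Γ₀(N(ρ̄'))`.  Proof: `ρ̄'` is irreducible (`hirr`, Thm. 2.2) and odd; `hKW` (for Thms. 1.3 + 3.1)
gives `f` of weight `k(ρ̄') = 2` (`hwt`) and level `N(ρ̄') ∣ 32`
(`denes_serreLevel_dvd_thirtyTwo_of_odd`, Lemma 2.1 (1)); `ε_f = 1` since `p ∤ φ(N(ρ̄')) ∣ 16`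
(`nebentypus_eq_one_of_isGaloisRepOfNewform1Int_of_not_dvd_totient`), so `f` descends to a newform
`g` on `Γ₀(N(ρ̄'))` (`exists_isNewform0_coe_eq_of_nebentypus_eq_one`); as `S₂(Γ₀(M)) = 0` for
`M ∣ 16` (`cuspForm_two_gamma0_eq_zero_of_dvd_sixteen`), `N(ρ̄') = 32`
(`eq_thirtyTwo_of_dvd_of_ne_zero`).  The printed "`a_ℓ(f) = trace(ρ(Frob_ℓ))` for `ℓ ∤ pN(ρ)`" is
read off `IsGaloisRepOfNewform1Int` by `exists_coeff_eq_lFunction_of_isGaloisRepOfNewform1Int` (at the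
odd primes `ℓ ≠ p`, `ℓ ∤ abc`). [cite: DarmonMerel1997, Thm. 3.1 and §4 (first paragraph)]
[cite: Serre1987, §4.2–4.3] [cite: KhareWintenberger2009, Thm. 1.2] -/
theorem denes_serreLevel_eq_thirtyTwo_of_odd_of_khare_wintenberger_of_frey_local {p : ℕ}
    [Fact p.Prime] (h5 : 5 ≤ p) {a b c : ℤ} (h0 : a * b * c ≠ 0) (hac : IsCoprime a c)
    (ha4 : a ≡ -1 [ZMOD 4]) (hc : Odd c) (h : a ^ p + b ^ p = 2 * c ^ p)
    {ρ : ModPGaloisRep ℚ (ZMod p) 2}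
    (hρ : (freyCurve (a ^ p) (-(2 * c ^ p))).IsTorsionGaloisRep p ρ)
    (k : Type) [Field k] [TopologicalSpace k] [DiscreteTopology k] [CharP k p] [IsAlgClosed k]
    (j : ZMod p →+* k) :
    haveI : NeZero (serreLevel p (FramedRep.baseChange j continuous_of_discreteTopology ρ)) :=
      ⟨fun h0' ↦ not_dvd_serreLevel p _ (h0' ▸ dvd_zero p)⟩
    serreLevel p (FramedRep.baseChange j continuous_of_discreteTopology ρ) = 32 ∧
      ∃ (f : CuspForm (Gamma1
          (serreLevel p (FramedRep.baseChange j continuous_of_discreteTopology ρ))) 2)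
        (ιf : coeffCharIntegers f →+* k),
        IsNewform1 f ∧ nebentypus f = 1 ∧
          IsGaloisRepOfNewform1Int f ιf
            {q | q ∣ serreLevel p (FramedRep.baseChange j continuous_of_discreteTopology ρ) * p}
            (FramedRep.baseChange j continuous_of_discreteTopology ρ) ∧
          ∃ g : CuspForm (Gamma0
              (serreLevel p (FramedRep.baseChange j continuous_of_discreteTopology ρ))) 2,
            IsNewform0 g ∧ (⇑g : UpperHalfPlane → ℂ) = ⇑f := by
  classical
  have hp : p.Prime := Fact.out
  have hp2 : p ≠ 2 := by omega
  have hodd : Odd p := hp.odd_of_ne_two hp2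
  have ha : Odd a := odd_of_modEq_neg_one_four ha4
  have hcop : IsCoprime (a ^ p) (-(2 * c ^ p)) := isCoprime_denes_frey hac ha
  have hne := denes_frey_ne_zero h h0
  have hA : a ^ p ≡ -1 [ZMOD 4] := pow_modEq_neg_one_four hodd ha4
  have hB2 : (2 : ℤ) ∣ -(2 * c ^ p) := dvd_neg.mpr (dvd_mul_right 2 _)
  set W : WeierstrassCurve ℚ := freyCurve (a ^ p) (-(2 * c ^ p)) with hW
  haveI hWE : W.IsElliptic := isElliptic_freyCurve hne
  set ρ' : ModPGaloisRep ℚ k 2 := FramedRep.baseChange j continuous_of_discreteTopology ρ with hρ'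
  /- Step 1. `ρ̄'` is irreducible and odd. -/
  have habs := isAbsolutelyIrreducible_of_hasIrreducibleModPGaloisRep W hp2
    (hirr _ _ p hp h5 hcop hne hA hB2) hρ
  have hirr' : ρ'.toGaloisRep.IsIrreducible := by
    rw [← ModPGaloisRep.isIrreducible_iff_toGaloisRep]
    exact habs.isIrreducible_baseChange k j _
  have hodd' : FramedGaloisRep.IsOdd ρ' :=
    (ModPGaloisRep.isOdd_of_det_eq_modPCyclotomicCharacterZMod ρ
      (W.det_eq_modPCyclotomicCharacter_of_isTorsionGaloisRep_holds p ρ hρ)).baseChange j _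
  /- Step 2. Serre's conjecture. -/
  obtain ⟨loc⟩ := nonempty_localRestrictionAt p ρ'
  obtain ⟨ι⟩ := nonempty_ringHom_residue (k := k) p loc.F loc.residueFieldCard_eq
  /- Step 3. The weight is `2` (`hwt`). -/
  set vp : HeightOneSpectrum ℤ := (primesEquiv (R := ℤ)).symm ⟨p, hp⟩ with hvp_def
  have hvp : natGenerator vp = p :=
    Literature.NumberTheory.EllipticCurves.Rat.natGenerator_primesEquiv_symm ⟨p, hp⟩
  have hpord : p ∣ W.ordMinimalDiscriminant vp :=
    dvd_ordMinimalDiscriminant_freyCurve_denes h h0 hac ha vp (by rw [hvp]; exact hp2)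
  have hsemi : W.IsSemistableAt vp :=
    isSemistableAt_freyCurve_denes h h0 hac ha vp (by rw [hvp]; exact hp2)
  have hw : (serreWeight p ρ' loc ι : ℤ) = 2 := by
    have h2 : serreWeight p ρ' loc ι = 2 := hwt W p h5 hsemi hpord ρ hρ k j loc ι
    rw [h2]; rfl
  obtain ⟨f, ιf, hf, hgal⟩ := hKW p k ρ' hirr' hodd' loc ι
  revert hgal hf ιf f
  rw [hw]
  intro f ιf hf hgal
  /- Step 4. The level divides `32` (Lemma 2.1 (1)); the nebentypus is trivial.  (No `set` for
  the level here: abstracting it in the dependent goal is too expensive.) -/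
  haveI hNz : NeZero (serreLevel p ρ') := ⟨fun h0' ↦ not_dvd_serreLevel p ρ' (h0' ▸ dvd_zero p)⟩
  have hN32 : serreLevel p ρ' ∣ 32 :=
    denes_serreLevel_dvd_thirtyTwo_of_odd hlevN hTate h0 hac ha hc h hρ k j
  have hε : nebentypus f = 1 :=
    nebentypus_eq_one_of_isGaloisRepOfNewform1Int_of_not_dvd_totient W hρ j
      (not_dvd_totient_of_dvd_thirtyTwo hN32 hp hp2) ιf hgal (max 2 (a * b * c).natAbs)
      fun q hq hqB ↦
        not_dvd_conductorNorm_freyCurve_denes_of_lt (by omega) h h0 hac ha hq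
          (fun h' ↦ (lt_of_le_of_lt (le_max_left _ _) hqB).ne' h')
          (lt_of_le_of_lt (le_max_right _ _) hqB)
  /- Step 5. Descent to `Γ₀(N)`; the levels dividing `16` carry no cusp forms, so `N = 32`. -/
  obtain ⟨g, hg, hgf⟩ := exists_isNewform0_coe_eq_of_nebentypus_eq_one hf hε
  have hN : serreLevel p ρ' = 32 := eq_thirtyTwo_of_dvd_of_ne_zero hN32 g hg.ne_zero
  exact ⟨hN, f, ιf, hf, hε, hgal, g, hg, hgf⟩

end SerreRoad

/-! ## Part D. The same on the three named facts, and the refined assembly of the Main Theorem -/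

section NamedFacts

variable
  (hKW : ∀ (p : ℕ) [Fact p.Prime] (k : Type) [Field k] [TopologicalSpace k] [DiscreteTopology k],
    khare_wintenberger p k)
  (hMK : mazurKenku_exists_cyclic_isogeny)
  (hOS : ∀ (W : WeierstrassCurve ℚ) (ℓ : ℕ) [Fact ℓ.Prime],
    W.artinConductorExponent_tate_eq_conductorExponent_of_isElliptic ℓ)
  (hwt : ∀ (W : WeierstrassCurve ℚ) [W.IsElliptic] (p : ℕ) [Fact p.Prime], 5 ≤ p →
    W.IsSemistableAt ((primesEquiv (R := ℤ)).symm ⟨p, Fact.out⟩) →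
    p ∣ W.ordMinimalDiscriminant ((primesEquiv (R := ℤ)).symm ⟨p, Fact.out⟩) →
    ∀ ρ : ModPGaloisRep ℚ (ZMod p) 2, W.IsTorsionGaloisRep p ρ →
      ∀ (k : Type) [Field k] [TopologicalSpace k] [DiscreteTopology k] [CharP k p]
        [IsAlgClosed k] (j : ZMod p →+* k)
        (loc : LocalRestrictionAt p (FramedRep.baseChange j continuous_of_discreteTopology ρ))
        (ι : absIntegers 𝒪[loc.F] loc.F ⧸ absMaximalIdeal loc.F →+* k),
        serreWeight p (FramedRep.baseChange j continuous_of_discreteTopology ρ) loc ι = 2)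
  (hTate : ∀ (W : WeierstrassCurve ℚ) [W.IsElliptic] (p : ℕ) [Fact p.Prime],
    ∀ ρ : ModPGaloisRep ℚ (ZMod p) 2, W.IsTorsionGaloisRep p ρ →
      ∀ (k : Type) [Field k] [TopologicalSpace k] [DiscreteTopology k] [CharP k p]
        [IsAlgClosed k] (j : ZMod p →+* k) (v : HeightOneSpectrum ℤ),
        natGenerator v ≠ p → W.IsSemistableAt v → p ∣ W.ordMinimalDiscriminant v →
          ¬ natGenerator v ∣ serreLevel p (FramedRep.baseChange j continuous_of_discreteTopology ρ))

include hKW hMK hOS hwt hTate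

/-- **Darmon–Merel 1997, Cor. 3.2 (1), from `khare_wintenberger`, `mazurKenku_exists_cyclic_isogeny`,
the exponentwise Ogg–Saito fact, and Serre's two local statements (4.1.11)/(4.1.12)** — the
hypothesis list of the sibling `ribet1997_twoPowerFermat_of_khare_wintenberger_of_mazurKenku_of_tate`
(Ribet's Thm. 3 for `α ≥ 2`), now for `α = 1`: no solution of `aᵖ + bᵖ = 2cᵖ`, `p ≥ 5` prime, with
`abc ≠ 0`, `gcd(a, b) = gcd(a, c) = 1` and `c` even.  `hirr` is supplied by
`hasIrreducibleModPGaloisRep_freyCurve_of_mazurKenku` (DM Thm. 2.2: a Frey curve has full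
rational `2`-torsion, Lemma 1.2 (1)) and `hlevN` by `serreLevel_baseChange_dvd_conductorNorm_of_tate`.
[cite: DarmonMerel1997, Cor. 3.2 (1)] [cite: KhareWintenberger2009, Thm. 1.2]
[cite: Mazur1978, Thm. 1] [cite: Serre1987, §4.1 (4.1.11)–(4.1.12), (4.6.3)] -/
theorem denes_false_of_even_of_khare_wintenberger_of_mazurKenku_of_tate {p : ℕ} (hp : p.Prime)
    (h5 : 5 ≤ p) {a b c : ℤ} (h0 : a * b * c ≠ 0) (hab : IsCoprime a b) (hac : IsCoprime a c)
    (hc : 2 ∣ c) (h : a ^ p + b ^ p = 2 * c ^ p) : False :=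
  denes_false_of_even_of_khare_wintenberger_of_frey_local hKW
    (fun _ _ _ hp' h5' _ h0' _ _ ↦ hasIrreducibleModPGaloisRep_freyCurve_of_mazurKenku hMK h0' hp' h5')
    hwt
    (fun W _ p _ ρ hρ k _ _ _ _ _ j ↦ serreLevel_baseChange_dvd_conductorNorm_of_tate hOS W p ρ hρ k j)
    hTate hp h5 h0 hab hac hc h

/-- **Dénes' conjecture in the coordinates of the named fact, even case** (Ribet 1997, Thm. 3,
second sentence; Darmon–Merel Cor. 3.2 (1)): under the same hypotheses, a pairwise coprime
solution of `xᵖ + 2yᵖ + zᵖ = 0` with `xyz ≠ 0`, `p ≥ 5` prime, has `y` odd (substitute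
`(a, b, c) = (x, z, −y)`). [cite: DarmonMerel1997, Cor. 3.2 (1)] [cite: Ribet1997, Thm. 3] -/
theorem denesEquation_odd_of_khare_wintenberger_of_mazurKenku_of_tate {p : ℕ} (hp : p.Prime)
    (h5 : 5 ≤ p) {x y z : ℤ} (h0 : x * y * z ≠ 0) (hxy : IsCoprime x y) (hxz : IsCoprime x z)
    (heq : x ^ p + 2 * y ^ p + z ^ p = 0) : ¬ 2 ∣ y := by
  intro hy
  have hodd : Odd p := hp.odd_of_ne_two (by omega)
  have h0' : x * z * -y ≠ 0 := by
    intro h'; apply h0; linear_combination -h'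
  have heq' : x ^ p + z ^ p = 2 * (-y) ^ p := by
    rw [hodd.neg_pow]; linear_combination heq
  exact denes_false_of_even_of_khare_wintenberger_of_mazurKenku_of_tate hKW hMK hOS hwt hTate hp h5
    h0' hxz hxy.neg_right (dvd_neg.mpr hy) heq'

/-- **Darmon–Merel 1997, Main Theorem (1) for prime exponents `p ≥ 5` — the named fact
`darmonMerel1997_denesEquation` — from Serre's road for the even case and the printed conclusions
of the deep inputs for the odd case.**  Granted the three named facts `khare_wintenberger`,
`mazurKenku_exists_cyclic_isogeny`, `artinConductorExponent_tate_eq_conductorExponent_of_isElliptic`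
and Serre's (4.1.11)/(4.1.12) (`hwt`, `hTate`) — which settle every solution with `abc` even for
all `p ≥ 5` (`denes_false_of_even_of_khare_wintenberger_of_mazurKenku_of_tate`, Cor. 3.2 (1)) —
the Main Theorem follows from:

* (i′) Dénes 1952 (reference [7] of the source) for `p = 5`, needed only for `abc` odd:
  `abc = ±1`;
* (ii′) for prime `p ≥ 7` and `abc` **odd**: `j(E) ∈ ℤ[1/p]` (Thm. 8.1 applied through Thm. 1.3,
  Lemma 1.2, Props. 4.1–4.3: image of `ρ` = normaliser of a non-split Cartan subgroup, the case
  `p ≡ 1 (mod 4)` being Prop. 4.2) and `p ∤ abc` (Cor. 4.4),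

by the §9 assembly `darmonMerel1997_denesEquation_of_denes_of_large` (Cor. 9.1).  Compared with
that theorem, the even case is no longer assumed.
[cite: DarmonMerel1997, Cor. 3.2 (1), Cor. 9.1 and §9] [cite: KhareWintenberger2009, Thm. 1.2] -/
theorem darmonMerel1997_denesEquation_of_khare_wintenberger_of_odd
    (hfive : ∀ a b c : ℤ, a * b * c ≠ 0 → IsCoprime a b → IsCoprime a c → IsCoprime b c →
      ¬ 2 ∣ c → a ^ 5 + b ^ 5 = 2 * c ^ 5 → a * b * c = 1 ∨ a * b * c = -1)
    (hlarge : ∀ p : ℕ, p.Prime → 7 ≤ p → ∀ a b c : ℤ, a * b * c ≠ 0 → IsCoprime a b →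
      IsCoprime a c → IsCoprime b c → ¬ 2 ∣ c → a ^ p + b ^ p = 2 * c ^ p →
      ∀ [(freyCurve (a ^ p) (-(2 * c ^ p))).IsElliptic],
        (∃ n : ℕ, ∃ m : ℤ, (freyCurve (a ^ p) (-(2 * c ^ p))).j = m / (p : ℚ) ^ n) ∧
          ¬ (p : ℤ) ∣ a * b * c) :
    darmonMerel1997_denesEquation := by
  refine darmonMerel1997_denesEquation_of_denes_of_large ?_ ?_
  · intro a b c h0 hab hac hbc heq
    by_cases hc : 2 ∣ c
    · exact (denes_false_of_even_of_khare_wintenberger_of_mazurKenku_of_tate hKW hMK hOS hwt hTate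
        (by norm_num) le_rfl h0 hab hac hc heq).elim
    · exact hfive a b c h0 hab hac hbc hc heq
  · intro p hp h7 a b c h0 hab hac hbc heq _
    by_cases hc : 2 ∣ c
    · exact (denes_false_of_even_of_khare_wintenberger_of_mazurKenku_of_tate hKW hMK hOS hwt hTate
        hp (by omega) h0 hab hac hc heq).elim
    · exact hlarge p hp h7 a b c h0 hab hac hbc hc heq

end NamedFacts

/-! ## Part E. §4, p. 10: "`ρ` is isomorphic to the Galois representation … of `X₀(32)`"
(appended 2026-08-16)

Darmon–Merel, §4, p. 10: "The curves `X₀(32)` and `X₀(27)` are both curves of genus `1` … given by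
the equations `X₀(32) : Y² = X³ − X` … (Note that these curves are also the Frey curves that are
associated to the trivial solution `(1, 1, 1)` of equation (1) …) It follows that `ρ` is isomorphic
to the Galois representation given by the action on the `p`-division points of the elliptic curve
`X₀(32)`".  In the tree the Frey curve of the trivial solution is `freyCurve 1 (-2)`
(`Y² = X(X − 1)(X − 2)`, isomorphic to `Y² = X³ − X` by `variableChange_freyCurve_trivial`).  We
prove the statement in trace form — `a_q(E) ≡ a_q(X₀(32)) (mod p)` for every prime
`q ∤ 2p · abc` — which for the irreducible `ρ` is equivalent to the printed isomorphism
(Brauer–Nesbitt and Chebotarev, not invoked here).  Besides the Serre-road hypotheses this uses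
the modularity of the single curve `X₀(32)` in the tree's form `exists_isNewformOf` (DM Thm. 1.3;
classically Deuring–Hecke for this CM curve): its newform lives on `Γ₀(32)`, where there is only
one normalised form (`finrank_cuspForm_two_gamma0_thirtyTwo`). -/

section XZeroThirtyTwo

/-- **The Frey curve of the trivial solution has conductor `32`** (it is `X₀(32)`; DM Prop. 1.1 (1)
with `abc = 1` odd: `N = 2⁵ rad(1)`). [cite: DarmonMerel1997, §4 (p. 10) and Prop. 1.1 (1)] -/
theorem conductorNorm_freyCurve_trivial : (freyCurve 1 (-2)).conductorNorm ℤ = 32 := by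
  have h := conductorNorm_freyCurve_denes_of_odd (p := 1) (a := 1) (b := 1) (c := 1) le_rfl
    (by norm_num) (by norm_num) isCoprime_one_left odd_one odd_one
  norm_num at h
  exact h

/-- Transport of a `Γ₀(M)`-newform along `M = 32` (bookkeeping for the dependent level).
[folklore] -/
theorem exists_isNewform0_thirtyTwo_of_eq {M : ℕ} [NeZero M] (hM : M = 32)
    {g : CuspForm (Gamma0 M) 2} (hg : IsNewform0 g) :
    ∃ g' : CuspForm (Gamma0 32) 2, IsNewform0 g' ∧ (⇑g' : UpperHalfPlane → ℂ) = ⇑g := by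
  subst hM
  exact ⟨g, hg, rfl⟩

/-- **There is only one newform of weight `2` on `Γ₀(32)`**: `S₂(Γ₀(32))` is a line
(`finrank_cuspForm_two_gamma0_thirtyTwo`, the genus of `X₀(32)` being `1`) and newforms are
normalised, `a₁ = 1`. [cite: DarmonMerel1997, §4 (p. 10)] -/
theorem eq_of_isNewform0_thirtyTwo {g₁ g₂ : CuspForm (Gamma0 32) 2} (h₁ : IsNewform0 g₁)
    (h₂ : IsNewform0 g₂) : g₁ = g₂ := by
  obtain ⟨c, hc⟩ :=
    (finrank_eq_one_iff_of_nonzero' g₁ h₁.ne_zero).mp finrank_cuspForm_two_gamma0_thirtyTwo g₂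
  have hn₁ : cuspCoeff g₁ 1 = 1 := h₁.2.2
  have hn₂ : cuspCoeff g₂ 1 = 1 := h₂.2.2
  have hc1 : c = 1 := by
    have h := congrArg (cuspCoeff · 1) hc
    simp only [cuspCoeff_smul, hn₁, hn₂, mul_one] at h
    exact h
  rw [← hc, hc1, one_smul]

/-- **The Fourier coefficients of the newform of level `32` are the `aₙ` of `X₀(32)`**: granted
modularity in the tree's form `exists_isNewformOf` (applied to the single curve
`freyCurve 1 (-2) ≅ X₀(32)`, conductor `32`), every newform `g` of weight `2` on `Γ₀(M)`, `M = 32`,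
has `aₙ(g) = aₙ(X₀(32))` for all `n` (`eq_of_isNewform0_thirtyTwo`).
[cite: DarmonMerel1997, §4 (p. 10)] -/
theorem cuspCoeff_eq_lFunction_freyCurve_trivial_of_isNewform0 (hmod : exists_isNewformOf)
    {M : ℕ} [NeZero M] (hM : M = 32) {g : CuspForm (Gamma0 M) 2} (hg : IsNewform0 g) (n : ℕ) :
    cuspCoeff g n = ((freyCurve 1 (-2)).LFunction n : ℂ) := by
  subst hM
  haveI := isElliptic_freyCurve_trivial
  have h32 : (freyCurve 1 (-2)).conductorNorm ℤ = 32 := conductorNorm_freyCurve_trivial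
  haveI : NeZero ((freyCurve 1 (-2)).conductorNorm ℤ) := ⟨by rw [h32]; norm_num⟩
  obtain ⟨F, hF⟩ := hmod (freyCurve 1 (-2))
  obtain ⟨F', hF', hFF'⟩ := exists_isNewform0_thirtyTwo_of_eq h32 hF.1
  rw [eq_of_isNewform0_thirtyTwo hg hF', ← hF.2 n]
  show (UpperHalfPlane.qExpansion 1 ⇑F').coeff n = (UpperHalfPlane.qExpansion 1 ⇑F).coeff n
  rw [hFF']

variable
  (hKW : ∀ (p : ℕ) [Fact p.Prime] (k : Type) [Field k] [TopologicalSpace k] [DiscreteTopology k],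
    khare_wintenberger p k)
  (hirr : ∀ (A B : ℤ) (p : ℕ), p.Prime → 5 ≤ p → IsCoprime A B → A * B * (A + B) ≠ 0 →
    A ≡ -1 [ZMOD 4] → (2 : ℤ) ∣ B → (freyCurve A B).HasIrreducibleModPGaloisRep p)
  (hMK : mazurKenku_exists_cyclic_isogeny)
  (hOS : ∀ (W : WeierstrassCurve ℚ) (ℓ : ℕ) [Fact ℓ.Prime],
    W.artinConductorExponent_tate_eq_conductorExponent_of_isElliptic ℓ)
  (hwt : ∀ (W : WeierstrassCurve ℚ) [W.IsElliptic] (p : ℕ) [Fact p.Prime], 5 ≤ p →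
    W.IsSemistableAt ((primesEquiv (R := ℤ)).symm ⟨p, Fact.out⟩) →
    p ∣ W.ordMinimalDiscriminant ((primesEquiv (R := ℤ)).symm ⟨p, Fact.out⟩) →
    ∀ ρ : ModPGaloisRep ℚ (ZMod p) 2, W.IsTorsionGaloisRep p ρ →
      ∀ (k : Type) [Field k] [TopologicalSpace k] [DiscreteTopology k] [CharP k p]
        [IsAlgClosed k] (j : ZMod p →+* k)
        (loc : LocalRestrictionAt p (FramedRep.baseChange j continuous_of_discreteTopology ρ))
        (ι : absIntegers 𝒪[loc.F] loc.F ⧸ absMaximalIdeal loc.F →+* k),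
        serreWeight p (FramedRep.baseChange j continuous_of_discreteTopology ρ) loc ι = 2)
  (hlevN : ∀ (W : WeierstrassCurve ℚ) [W.IsElliptic] (p : ℕ) [Fact p.Prime],
    ∀ ρ : ModPGaloisRep ℚ (ZMod p) 2, W.IsTorsionGaloisRep p ρ →
      ∀ (k : Type) [Field k] [TopologicalSpace k] [DiscreteTopology k] [CharP k p]
        [IsAlgClosed k] (j : ZMod p →+* k),
        serreLevel p (FramedRep.baseChange j continuous_of_discreteTopology ρ) ∣
          W.conductorNorm ℤ)
  (hTate : ∀ (W : WeierstrassCurve ℚ) [W.IsElliptic] (p : ℕ) [Fact p.Prime],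
    ∀ ρ : ModPGaloisRep ℚ (ZMod p) 2, W.IsTorsionGaloisRep p ρ →
      ∀ (k : Type) [Field k] [TopologicalSpace k] [DiscreteTopology k] [CharP k p]
        [IsAlgClosed k] (j : ZMod p →+* k) (v : HeightOneSpectrum ℤ),
        natGenerator v ≠ p → W.IsSemistableAt v → p ∣ W.ordMinimalDiscriminant v →
          ¬ natGenerator v ∣ serreLevel p (FramedRep.baseChange j continuous_of_discreteTopology ρ))
  (hmod : exists_isNewformOf)

include hKW hirr hwt hlevN hTate hmod in
/-- **Darmon–Merel 1997, §4, p. 10, along Serre's road: "`ρ` is isomorphic to the Galois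
representation given by the action on the `p`-division points of the elliptic curve `X₀(32)`" —
trace form.**  For a solution of `aᵖ + bᵖ = 2cᵖ` with `p ≥ 5` prime, `abc ≠ 0`, `gcd(a, c) = 1`,
`a ≡ −1 (mod 4)` (§1) and `c` odd, and its Frey curve `E`: at every prime `q ∤ 2p` with `q ∤ abc`,
`a_q(E) ≡ a_q(X₀(32)) (mod p)`, where `X₀(32)` is taken as the Frey curve `freyCurve 1 (-2)` of the
trivial solution.  Proof: by `denes_serreLevel_eq_thirtyTwo_of_odd_of_khare_wintenberger_of_frey_local`
(Lemma 2.1, Thm. 3.1, §4 ¶1) `ρ̄_{E,p} ⊗ 𝔽̄_p` is attached along `ι : 𝓞_f → 𝔽̄_p` to a newform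
`f` of weight `2` with `⇑f = ⇑g`, `g` a newform on `Γ₀(32)`; so `ι(A) = a_q(E)` for the integral
`A ∈ 𝓞_f` over `a_q(f)` (`exists_coeff_eq_lFunction_of_isGaloisRepOfNewform1Int`; `q` is a prime of
good reduction, `dvd_conductorNorm_freyCurve_denes_iff`), while `a_q(f) = a_q(g) = a_q(X₀(32)) ∈ ℤ`
(`cuspCoeff_eq_lFunction_freyCurve_trivial_of_isNewform0`, via `hmod` = DM Thm. 1.3 for `X₀(32)`),
whence `A = a_q(X₀(32))` in `𝓞_f` (injectivity of `𝓞_f → ℂ`) and `a_q(E) = a_q(X₀(32))` in `𝔽̄_p`,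
i.e. in `𝔽_p`. [cite: DarmonMerel1997, §4 (p. 10)] [cite: Serre1987, §4.2–4.3]
[cite: KhareWintenberger2009, Thm. 1.2] -/
theorem denes_lFunction_eq_trivial_of_odd_of_khare_wintenberger_of_frey_local {p : ℕ}
    (hp : p.Prime) (h5 : 5 ≤ p) {a b c : ℤ} (h0 : a * b * c ≠ 0) (hac : IsCoprime a c)
    (ha4 : a ≡ -1 [ZMOD 4]) (hc : Odd c) (h : a ^ p + b ^ p = 2 * c ^ p) {q : ℕ} (hq : q.Prime)
    (hq2 : q ≠ 2) (hqp : q ≠ p) (hqabc : ¬ (q : ℤ) ∣ a * b * c) :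
    (((freyCurve (a ^ p) (-(2 * c ^ p))).LFunction q : ℤ) : ZMod p) =
      (((freyCurve 1 (-2)).LFunction q : ℤ) : ZMod p) := by
  classical
  haveI hpF : Fact p.Prime := ⟨hp⟩
  have ha : Odd a := odd_of_modEq_neg_one_four ha4
  have hne := denes_frey_ne_zero h h0
  set W : WeierstrassCurve ℚ := freyCurve (a ^ p) (-(2 * c ^ p)) with hW
  haveI hWE : W.IsElliptic := isElliptic_freyCurve hne
  /- a framed model of `E[p]` over `𝔽̄_p` and the level-`32` newform of Thm. 3.1 / §4 ¶1 -/
  haveI : NeZero ((p : ℕ) : ℚ) := ⟨by exact_mod_cast hp.ne_zero⟩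
  obtain ⟨ρ, hρ⟩ := W.exists_isTorsionGaloisRep p
  letI : TopologicalSpace (AlgebraicClosure (ZMod p)) := ⊥
  haveI : DiscreteTopology (AlgebraicClosure (ZMod p)) := ⟨rfl⟩
  set j : ZMod p →+* AlgebraicClosure (ZMod p) := algebraMap (ZMod p) (AlgebraicClosure (ZMod p))
    with hj
  haveI : NeZero (serreLevel p (FramedRep.baseChange j continuous_of_discreteTopology ρ)) :=
    ⟨fun h0' ↦ not_dvd_serreLevel p _ (h0' ▸ dvd_zero p)⟩
  obtain ⟨hN, f, ιf, -, -, hgal, g, hg, hgf⟩ :=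
    denes_serreLevel_eq_thirtyTwo_of_odd_of_khare_wintenberger_of_frey_local hKW hirr hwt hlevN
      hTate h5 h0 hac ha4 hc h hρ (AlgebraicClosure (ZMod p)) j
  /- `q` is prime to `32 p` and of good reduction -/
  have hqS : q ∉ {q | q ∣ serreLevel p (FramedRep.baseChange j continuous_of_discreteTopology ρ) * p} := by
    intro h'
    rcases (Nat.Prime.dvd_mul hq).mp h' with h1 | h1
    · exact hq2 (denes_eq_two_of_prime_dvd_serreLevel hTate h0 hac ha h hρ _ j hq h1)
    · exact hqp ((Nat.prime_dvd_prime_iff_eq hq hp).mp h1)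
  have hgood : ¬ q ∣ W.conductorNorm ℤ := by
    rw [dvd_conductorNorm_freyCurve_denes_iff (by omega) h h0 hac ha hq hq2]
    exact hqabc
  obtain ⟨A, hAe, hAι⟩ :=
    exists_coeff_eq_lFunction_of_isGaloisRepOfNewform1Int W hρ j ιf hgal hq hqS hqp hgood
  /- `a_q(f) = a_q(X₀(32))` in `ℂ`, so `A = a_q(X₀(32))` in `𝓞_f` -/
  have hcoef : (UpperHalfPlane.qExpansion 1 ⇑f).coeff q = ((freyCurve 1 (-2)).LFunction q : ℂ) := by
    have h' := cuspCoeff_eq_lFunction_freyCurve_trivial_of_isNewform0 hmod hN hg q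
    simpa only [cuspCoeff, hgf] using h'
  have hA : A = (((freyCurve 1 (-2)).LFunction q : ℤ) : coeffCharIntegers f) := by
    apply algebraMap_coeffCharIntegers_complex_injective f
    rw [RingHom.comp_apply, hAe, hcoef, map_intCast]
  /- conclude in `𝔽̄_p`, then in `𝔽_p` -/
  have hk : ((W.LFunction q : ℤ) : AlgebraicClosure (ZMod p)) =
      (((freyCurve 1 (-2)).LFunction q : ℤ) : AlgebraicClosure (ZMod p)) := by
    rw [← hAι, hA, map_intCast]
  apply j.injective
  rw [map_intCast, map_intCast]
  exact hk

include hKW hMK hOS hwt hTate hmod in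
/-- **DM §4, p. 10 (trace form) on the named facts**: `a_q(E) ≡ a_q(X₀(32)) (mod p)` for
`q ∤ 2p · abc`, granted `khare_wintenberger`, `mazurKenku_exists_cyclic_isogeny`, the exponentwise
Ogg–Saito fact, `exists_isNewformOf` (for `X₀(32)`), and Serre's (4.1.11)/(4.1.12).
[cite: DarmonMerel1997, §4 (p. 10)] -/
theorem denes_lFunction_eq_trivial_of_odd_of_khare_wintenberger_of_mazurKenku_of_tate {p : ℕ}
    (hp : p.Prime) (h5 : 5 ≤ p) {a b c : ℤ} (h0 : a * b * c ≠ 0) (hac : IsCoprime a c)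
    (ha4 : a ≡ -1 [ZMOD 4]) (hc : Odd c) (h : a ^ p + b ^ p = 2 * c ^ p) {q : ℕ} (hq : q.Prime)
    (hq2 : q ≠ 2) (hqp : q ≠ p) (hqabc : ¬ (q : ℤ) ∣ a * b * c) :
    (((freyCurve (a ^ p) (-(2 * c ^ p))).LFunction q : ℤ) : ZMod p) =
      (((freyCurve 1 (-2)).LFunction q : ℤ) : ZMod p) :=
  denes_lFunction_eq_trivial_of_odd_of_khare_wintenberger_of_frey_local hKW
    (fun _ _ _ hp' h5' _ h0' _ _ ↦ hasIrreducibleModPGaloisRep_freyCurve_of_mazurKenku hMK h0' hp' h5')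
    hwt
    (fun W _ p _ ρ hρ k _ _ _ _ _ j ↦ serreLevel_baseChange_dvd_conductorNorm_of_tate hOS W p ρ hρ k j)
    hTate hmod hp h5 h0 hac ha4 hc h hq hq2 hqp hqabc

end XZeroThirtyTwo

/-! ## Part F. `X₀(32)` is the congruent number curve `E₁`; Frobenius traces at the primes inert
in `ℚ(i)` (appended 2026-08-16)

Darmon–Merel, §4, p. 10 and Prop. 4.1 (1): `X₀(32) : Y² = X³ − X` "has complex multiplication by
the ring of Gaussian integers `ℤ[i]`", and the image of `ρ` is the normaliser of a Cartan subgroup,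
with `ρ(Gal(ℚ̄/ℚ(i)))` inside the Cartan — so the Frobenius of a prime `q` inert in `ℚ(i)`
(`q ≡ 3 (mod 4)`) lies in the non-trivial coset of the normaliser and has trace `0`.  In trace
form this is `a_q(E) ≡ a_q(X₀(32)) = 0 (mod p)`: the tree knows `X₀(32)` as the congruent number
curve `E₁ = congruentNumberCurve 1` (`y² = x³ − x`), isomorphic to the trivial Frey curve
`freyCurve 1 (-2)` (`variableChange_freyCurve_trivial`), and `a_q(E₁) = 0` at `q ≡ 3 (mod 4)`
(`lFunction_congruentNumberCurve_apply_prime_eq_zero`: `#E₁(𝔽_q) = q + 1`, Ireland–Rosen Ch. 18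
§4 Thm. 5). -/

section InertPrimes

/-- **The Frey curve of the trivial solution and the congruent number curve `E₁ : y² = x³ − x`
have the same `L`-function** (they are isomorphic over `ℚ`: `variableChange_freyCurve_trivial`;
Mathlib's `WeierstrassCurve.LFunction` is an isomorphism invariant, `LFunction_smul`).
[cite: DarmonMerel1997, §4 (p. 10)] -/
theorem lFunction_freyCurve_trivial_eq_congruentNumberCurve_one :
    (freyCurve 1 (-2)).LFunction = (congruentNumberCurve 1).LFunction := by
  haveI := isElliptic_freyCurve_trivial
  have hC : congruentNumberCurve 1 = (⟨1, 1, 0, 0⟩ : VariableChange ℚ) • freyCurve 1 (-2) := by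
    rw [variableChange_freyCurve_trivial]
    simp only [congruentNumberCurve, Nat.cast_one, one_pow]
  rw [hC, LFunction_smul]

/-- **`a_q(X₀(32)) = 0` at every prime `q ≡ 3 (mod 4)`** (supersingular reduction of the CM curve
`Y² = X³ − X` at the primes inert in `ℚ(i)`; the tree's
`lFunction_congruentNumberCurve_apply_prime_eq_zero` for `E₁`, Ireland–Rosen Ch. 18 §4 Thm. 5).
[cite: IrelandRosen1990, Ch. 18 §4, Theorem 5] -/
theorem lFunction_freyCurve_trivial_apply_prime_eq_zero {q : ℕ} (hq : q.Prime) (hq4 : q % 4 = 3) :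
    (freyCurve 1 (-2)).LFunction q = 0 := by
  rw [lFunction_freyCurve_trivial_eq_congruentNumberCurve_one]
  exact lFunction_congruentNumberCurve_apply_prime_eq_zero hq hq4 (n := 1)
    (fun h ↦ hq.one_lt.ne' (Nat.dvd_one.mp h))

variable
  (hKW : ∀ (p : ℕ) [Fact p.Prime] (k : Type) [Field k] [TopologicalSpace k] [DiscreteTopology k],
    khare_wintenberger p k)
  (hirr : ∀ (A B : ℤ) (p : ℕ), p.Prime → 5 ≤ p → IsCoprime A B → A * B * (A + B) ≠ 0 →
    A ≡ -1 [ZMOD 4] → (2 : ℤ) ∣ B → (freyCurve A B).HasIrreducibleModPGaloisRep p)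
  (hMK : mazurKenku_exists_cyclic_isogeny)
  (hOS : ∀ (W : WeierstrassCurve ℚ) (ℓ : ℕ) [Fact ℓ.Prime],
    W.artinConductorExponent_tate_eq_conductorExponent_of_isElliptic ℓ)
  (hwt : ∀ (W : WeierstrassCurve ℚ) [W.IsElliptic] (p : ℕ) [Fact p.Prime], 5 ≤ p →
    W.IsSemistableAt ((primesEquiv (R := ℤ)).symm ⟨p, Fact.out⟩) →
    p ∣ W.ordMinimalDiscriminant ((primesEquiv (R := ℤ)).symm ⟨p, Fact.out⟩) →
    ∀ ρ : ModPGaloisRep ℚ (ZMod p) 2, W.IsTorsionGaloisRep p ρ →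
      ∀ (k : Type) [Field k] [TopologicalSpace k] [DiscreteTopology k] [CharP k p]
        [IsAlgClosed k] (j : ZMod p →+* k)
        (loc : LocalRestrictionAt p (FramedRep.baseChange j continuous_of_discreteTopology ρ))
        (ι : absIntegers 𝒪[loc.F] loc.F ⧸ absMaximalIdeal loc.F →+* k),
        serreWeight p (FramedRep.baseChange j continuous_of_discreteTopology ρ) loc ι = 2)
  (hlevN : ∀ (W : WeierstrassCurve ℚ) [W.IsElliptic] (p : ℕ) [Fact p.Prime],
    ∀ ρ : ModPGaloisRep ℚ (ZMod p) 2, W.IsTorsionGaloisRep p ρ →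
      ∀ (k : Type) [Field k] [TopologicalSpace k] [DiscreteTopology k] [CharP k p]
        [IsAlgClosed k] (j : ZMod p →+* k),
        serreLevel p (FramedRep.baseChange j continuous_of_discreteTopology ρ) ∣
          W.conductorNorm ℤ)
  (hTate : ∀ (W : WeierstrassCurve ℚ) [W.IsElliptic] (p : ℕ) [Fact p.Prime],
    ∀ ρ : ModPGaloisRep ℚ (ZMod p) 2, W.IsTorsionGaloisRep p ρ →
      ∀ (k : Type) [Field k] [TopologicalSpace k] [DiscreteTopology k] [CharP k p]
        [IsAlgClosed k] (j : ZMod p →+* k) (v : HeightOneSpectrum ℤ),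
        natGenerator v ≠ p → W.IsSemistableAt v → p ∣ W.ordMinimalDiscriminant v →
          ¬ natGenerator v ∣ serreLevel p (FramedRep.baseChange j continuous_of_discreteTopology ρ))
  (hmod : exists_isNewformOf)

include hKW hirr hwt hlevN hTate hmod in
/-- **Darmon–Merel 1997, Prop. 4.1 (1), trace content at the inert primes, along Serre's road:
`a_q(E) ≡ 0 (mod p)` for every prime `q ≡ 3 (mod 4)` with `q ∤ p · abc`** — for a solution of
`aᵖ + bᵖ = 2cᵖ` with `p ≥ 5` prime, `abc ≠ 0`, `gcd(a, c) = 1`, `a ≡ −1 (mod 4)`, `c` odd, and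
its Frey curve `E`.  (Printed: the image `G` of `ρ` "is the normalizer of a Cartan subgroup … the
field cut out by `ρ` is an abelian extension of `ℚ(i)`"; a Frobenius at a prime inert in `ℚ(i)`
then lies in `G ∖ C` and is traceless.)  Proof: `a_q(E) ≡ a_q(X₀(32)) (mod p)`
(`denes_lFunction_eq_trivial_of_odd_of_khare_wintenberger_of_frey_local`, §4 p. 10) and
`a_q(X₀(32)) = 0` (`lFunction_freyCurve_trivial_apply_prime_eq_zero`).
[cite: DarmonMerel1997, Prop. 4.1 (1) and §4 (p. 10)] [cite: IrelandRosen1990, Ch. 18 §4, Theorem 5] -/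
theorem denes_lFunction_eq_zero_of_mod_four_eq_three_of_khare_wintenberger_of_frey_local {p : ℕ}
    (hp : p.Prime) (h5 : 5 ≤ p) {a b c : ℤ} (h0 : a * b * c ≠ 0) (hac : IsCoprime a c)
    (ha4 : a ≡ -1 [ZMOD 4]) (hc : Odd c) (h : a ^ p + b ^ p = 2 * c ^ p) {q : ℕ} (hq : q.Prime)
    (hq4 : q % 4 = 3) (hqp : q ≠ p) (hqabc : ¬ (q : ℤ) ∣ a * b * c) :
    (((freyCurve (a ^ p) (-(2 * c ^ p))).LFunction q : ℤ) : ZMod p) = 0 := by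
  have hq2 : q ≠ 2 := by
    rintro rfl
    norm_num at hq4
  rw [denes_lFunction_eq_trivial_of_odd_of_khare_wintenberger_of_frey_local hKW hirr hwt hlevN hTate
      hmod hp h5 h0 hac ha4 hc h hq hq2 hqp hqabc,
    lFunction_freyCurve_trivial_apply_prime_eq_zero hq hq4, Int.cast_zero]

include hKW hMK hOS hwt hTate hmod in
/-- **DM Prop. 4.1 (1), trace content at the inert primes, on the named facts**: `a_q(E) ≡ 0
(mod p)` for primes `q ≡ 3 (mod 4)`, `q ∤ p · abc`, granted `khare_wintenberger`,
`mazurKenku_exists_cyclic_isogeny`, the exponentwise Ogg–Saito fact, `exists_isNewformOf` (for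
`X₀(32)`) and Serre's (4.1.11)/(4.1.12). [cite: DarmonMerel1997, Prop. 4.1 (1) and §4 (p. 10)] -/
theorem denes_lFunction_eq_zero_of_mod_four_eq_three_of_khare_wintenberger_of_mazurKenku_of_tate
    {p : ℕ} (hp : p.Prime) (h5 : 5 ≤ p) {a b c : ℤ} (h0 : a * b * c ≠ 0) (hac : IsCoprime a c)
    (ha4 : a ≡ -1 [ZMOD 4]) (hc : Odd c) (h : a ^ p + b ^ p = 2 * c ^ p) {q : ℕ} (hq : q.Prime)
    (hq4 : q % 4 = 3) (hqp : q ≠ p) (hqabc : ¬ (q : ℤ) ∣ a * b * c) :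
    (((freyCurve (a ^ p) (-(2 * c ^ p))).LFunction q : ℤ) : ZMod p) = 0 :=
  denes_lFunction_eq_zero_of_mod_four_eq_three_of_khare_wintenberger_of_frey_local hKW
    (fun _ _ _ hp' h5' _ h0' _ _ ↦ hasIrreducibleModPGaloisRep_freyCurve_of_mazurKenku hMK h0' hp' h5')
    hwt
    (fun W _ p _ ρ hρ k _ _ _ _ _ j ↦ serreLevel_baseChange_dvd_conductorNorm_of_tate hOS W p ρ hρ k j)
    hTate hmod hp h5 h0 hac ha4 hc h hq hq4 hqp hqabc

end InertPrimes

end Literature.NumberTheory.DiophantineGeometry
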